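import Summits.BirchSwinnertonDyer.BirchSwinnertonDyer.Theorems.MordellShaFreeCutThreeAdicHsiehDescentUnrPeriod
import Summits.BirchSwinnertonDyer.BirchSwinnertonDyer.Theorems.MordellShaFreeCutRoadsMeetFromPrint
import Summits.BirchSwinnertonDyer.BirchSwinnertonDyer.Theorems.MordellShaFreeCutResidualExistenceFromPrint
import Summits.BirchSwinnertonDyer.BirchSwinnertonDyer.Theorems.MordellShaFreeCutThreeAdicBDPValueReciprocity
import HarnessLib

set_option linter.dupNamespace false
set_option autoImplicit false

/-! # Route `MordellShaFreeCut` (rung S2b) — the EXISTENCE HALF of the BDP road from TWO named facts {(T1) Hsieh 2014 Thm A,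
BDP13 Thm 5.5} (Tate–Sen REMOVED), and the S2b censuses re-issued without `TateSenCharacterVanishing 3`

Cell `bsd-cn100`, prover seat `bsd-cn100-s2b-c3` (g8). Supports, does not close, stmt-BirchSwinnertonDyer-19160 (crux B);
serves stmt-19159 (crux A, line v6bq / proposed v6br). THEOREMS ONLY (one-line compositions; 0 def, 0 new fact). The Tate–Sen-free
pointwise engine `MordellShaFreeCutThreeAdicHsiehDescentUnrPeriod.threeAdicHsiehDescentAt_of_valueReciprocityAt` (x11b3 desc3-p1
g3's finite-orbit argument at `j = 0`; possible because (T1) `Hsieh2014.thmA_exists_isHsiehLFunction_unrPeriod_anyLevel` types the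
period as `Ωp : (unrIntegers 3)ˣ`) replaces `MordellShaFreeCutThreeAdicHsiehDescentAt` in every census of this seat's g8 pack;
the landed odd-`d_K` plumbing theorems take the existence statement as a HYPOTHESIS, so only the final compositions change.
* §1 `threeAdicHsiehDescent_of_valueReciprocity` — the NAMED residual `ThreeAdicHsiehDescent` (p481496) ⟸ the NAMED clause
  `ThreeAdicBDPValueReciprocity` (p487394) ALONE (was: + Tate–Sen, p487394's `…_of_tateSenCharacter_of_valueReciprocity`).
* §2 `threeAdicBDPElementExistsOddDisc_of_anyLevel_of_bdp2013` — (LB-exist) at every `j = 0` datum with `d_K` odd ⟸ (T1) +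
  `bertoliniDarmonPrasanna2013_centralValue_reciprocity` (was: + Tate–Sen, p489731).
* §3 censuses without Tate–Sen: `cruxB_of_anyLevel_of_bdp2013_of_value_of_wan` (crux B ⟸ six refereed facts + {(T1), BDP13}
  + (LB-bdp) + (LB-wan)), `cruxA_of_res_of_anyLevel_of_bdp2013_of_value_of_wan` (crux A ⟸ (res) + {(T1), BDP13} + (LB-bdp)
  + (LB-wan) + five facts), `leaf_of_res_of_anyLevel_of_bdp2013_of_value_of_wan` (route Assembly), and on the joined road
  `cruxB_of_namedFacts_of_anyLevel_of_bdp2013_of_value_of_reciprocity` (crux B ⟸ ELEVEN citation-borne facts + (LB-bdp) +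
  (ERL₃)).
NET: every named input of the S2b existence half is now a fact WITH READS/REVIEW ((T1): (E1″) two-read PASS; BDP13: reviewed
p419864); the cite-only `TateSenCharacterVanishing 3` is no longer an input of any S2b census of record. HONEST FRAMING:
CONDITIONAL compositions; nothing here proves (res), (LB-bdp), (LB-wan), (ERL₃), crux A/B, the leaf, Sylvester's conjecture or
any case of BSD. PARTITION: none — RANK axis.
[cite: Hsieh2014, Thm. A p. 712 and Thm. 5.6 (p. 23)] [cite: BertoliniDarmonPrasanna2013, Thm. 5.5 and (5.1.16) (p. 60)]
[cite: CastellaHsieh2018, §2.5] [cite: CastellaGrossiLeeSkinner2022, §5.2] [cite: AlpogeBhargavaShnidman2022, App. A Thm. 10.1, 10.8] -/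

noncomputable section

open scoped NumberField Classical
open NumberField IsDedekindDomain Field PowerSeries WeierstrassCurve
open Literature.NumberTheory.GaloisRepresentations Literature.NumberTheory.GaloisCohomology Literature.NumberTheory.EllipticCurves
  Literature.NumberTheory.EllipticCurves.ModularForms Literature.NumberTheory.QuadraticFields
  Literature.NumberTheory.EllipticCurves.Castella2018 Literature.NumberTheory.EllipticCurves.Kato2004
open Summit.BirchSwinnertonDyer.BirchSwinnertonDyer.Theses.MordellShaFreeCut
  (AnalyticRankOneOfRankOneFiniteShaThree RankPosOfThreeSelmerCorankOne)
open Summit.BirchSwinnertonDyer.BirchSwinnertonDyer.Theorems.MordellShaFreeCutThreeAdicBDPTriple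
  (ThreeAdicWanDivisibility ThreeAdicBDPValueAtOne)
open Summit.BirchSwinnertonDyer.BirchSwinnertonDyer.Theorems.MordellShaFreeCutCensusPTFree (threeAdicControlOfRankOne_holds)
open Summit.BirchSwinnertonDyer.BirchSwinnertonDyer.Theorems.MordellShaFreeCutResidualCensusPTFree
  (threeAdicControlOfCorankOne_of_locNonDegeneracy)
open Summit.BirchSwinnertonDyer.BirchSwinnertonDyer.Theorems.MordellShaFreeCutThreeAdicHsiehDescent (ThreeAdicHsiehDescent)
open Summit.BirchSwinnertonDyer.BirchSwinnertonDyer.Theorems.MordellShaFreeCutThreeAdicBDPValueReciprocity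
  (ThreeAdicBDPValueReciprocity)
open Summit.BirchSwinnertonDyer.BirchSwinnertonDyer.Theorems.MordellShaFreeCutKatoBDPReciprocity (ThreeAdicKatoBDPReciprocity)
open Summit.BirchSwinnertonDyer.BirchSwinnertonDyer.Theorems.MordellShaFreeCutThreeAdicHsiehDescentUnrPeriod
  (threeAdicHsiehDescentAt_of_valueReciprocityAt)
open Summit.BirchSwinnertonDyer.BirchSwinnertonDyer.Theorems.MordellShaFreeCutThreeAdicExistenceFromPrint
  (valueReciprocityAt_of_bdp2013 heegnerNonTorsionOddDisc_of_linkA_of_existsOddDisc_of_value_of_wan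
    analyticRankOne_of_facts_of_heegnerNonTorsionOddDisc)
open Summit.BirchSwinnertonDyer.BirchSwinnertonDyer.Theorems.MordellShaFreeCutResidualExistenceFromPrint
  (rankPosOddDisc_minimal_of_corankLinkA_of_existsOddDisc_of_value_of_wan)
open Summit.BirchSwinnertonDyer.BirchSwinnertonDyer.Theorems.MordellShaFreeCutRoadsMeetFromPrint
  (prFormulaAtThreeOddDisc_of_existsOddDisc_of_value_of_reciprocity heegnerNonTorsionOddDisc_of_prFormulaOddDisc_of_readings)

namespace Summit.BirchSwinnertonDyer.BirchSwinnertonDyer.Theorems.MordellShaFreeCutExistenceFromTwoFacts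

/-! ## §1 The named descent residual from the named reciprocity clause alone -/

/-- **`ThreeAdicHsiehDescent` ⟸ `ThreeAdicBDPValueReciprocity` ALONE (NO Tate–Sen)**: the node's Hsieh witness has
`Ω_p ∈ R₀ˣ`, so the Tate–Sen-free pointwise engine applies at every datum. CONDITIONAL on the clause (labelled, NOT discharged).
[cite: Hsieh2014, Thm. 5.6 (arXiv:1112.1580 p. 23)] [cite: CastellaHsieh2018, §2.5 (arXiv:1505.08165 p. 7)] -/
theorem threeAdicHsiehDescent_of_valueReciprocity (hVR : ThreeAdicBDPValueReciprocity) : ThreeAdicHsiehDescent := by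
  intro W _ _ hj K _ _ N _ Dt v κ γ _ hN hK hHN hsplit hv3 hκ ι' hι' A ΩK C Ωp Q hA hΩK hC hQ
  exact threeAdicHsiehDescentAt_of_valueReciprocityAt W hj K N Dt v κ γ hN hK hsplit hv3 hκ ι'
    (hVR W hj ι' K v κ Dt.f Dt.isNewformOf hN hK hHN hsplit hv3 hι' hκ) A ΩK C Ωp Q hA hΩK hC hQ

/-! ## §2 (LB-exist) at ODD `d_K` from TWO named facts -/

/-- **(LB-exist) at every `j = 0` datum with `d_K` ODD ⟸ {(T1) Hsieh 2014 Thm A at any level, BDP13 Thm 5.5} — NO Tate–Sen.**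
Proof = p489731's `threeAdicBDPElementExistsOddDisc_of_anyLevel_of_tateSen_of_bdp2013` with the Tate–Sen-free engine: `ι′`
(`X11b.exists_datum_forall_mem_iff`), `λ` (`X11b.lambdaSupplyAt`), the `R₀`-period Hsieh witness (`hT1`), value reciprocity at the
datum from BDP13 (`valueReciprocityAt_of_bdp2013`), descent by `threeAdicHsiehDescentAt_of_valueReciprocityAt`. CONDITIONAL on the
two named facts; credits nothing beyond the reduction. [cite: Hsieh2014, Thm. A p. 712 = Thm. 1 (arXiv:1112.1580 pp. 3–4)]
[cite: BertoliniDarmonPrasanna2013, Thm. 5.5 and (5.1.16) (p. 60)] -/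
theorem threeAdicBDPElementExistsOddDisc_of_anyLevel_of_bdp2013
    (hT1 : Hsieh2014.thmA_exists_isHsiehLFunction_unrPeriod_anyLevel)
    (hBDP : bertoliniDarmonPrasanna2013_centralValue_reciprocity) :
    ∀ (W : WeierstrassCurve ℚ) [W.IsElliptic] [W.IsGloballyMinimal], W.j = 0 →
      ∀ (K : Type) [Field K] [NumberField K] (N : ℕ) [NeZero N]
        (Dt : ModularParametrizationData W N)
        (v : HeightOneSpectrum (𝓞 K)) (κ : ZpExtension K 3) (γ : absoluteGaloisGroup K)
        [Fact (κ.IsTopGenerator γ)],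
      W.conductorNorm ℤ = N → IsImaginaryQuadratic K → Odd (NumberField.discr K) →
      SatisfiesHeegnerHypothesis N K → ((Ideal.span {(3 : ℤ)}).primesOver (𝓞 K)).ncard = 2 →
      ((3 : ℕ) : 𝓞 K) ∈ v.asIdeal → κ.IsAnticyclotomic →
      ∃ ι' : PadicAlgCl 3 ≃+* ℂ,
        (∀ (w : InfinitePlace K) (k : 𝓞 K), k ∈ v.asIdeal ↔ ‖ι'.symm (w.embedding (k : K))‖ < 1) ∧
        ∃ (ΩK : ℂ) (Ωp : (unrIntegers 3)ˣ) (L : UnrSeries 3),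
          ΩK ≠ 0 ∧ IsBDPLFunction ι' v κ γ Dt.f ΩK ((Ωp : unrIntegers 3) : ℂ_[3]) L := by
  intro W _ _ hj K _ _ N _ Dt v κ γ hγ hN hK hodd hHN hsplit hv3 hκ
  haveI : Fact (Nat.Prime 3) := ⟨Nat.prime_three⟩
  obtain ⟨ι₀⟩ := PadicAlgCl.nonempty_ringEquiv_complex 3
  obtain ⟨ι', -, hι'⟩ := Summit.BirchSwinnertonDyer.Rank1Residual.X11b.exists_datum_forall_mem_iff 3 ι₀ hK hv3
  obtain ⟨lam, rlam, hunit, hinfl, hAQ, hunrl, havl, hfacl⟩ :=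
    Summit.BirchSwinnertonDyer.Rank1Residual.X11b.lambdaSupplyAt (p := 3) (by norm_num) ι' K κ hK hκ
  obtain ⟨A, ΩK, C, Ωp, Q, hA, hΩK, hC, hQ⟩ :=
    hT1 ι' K v κ γ Dt.f lam rlam (by norm_num) Dt.isNewformOf.1 hK hsplit hv3 hι' hHN hunit hinfl hAQ
      hunrl havl hfacl hκ hγ.out
  have hVR := valueReciprocityAt_of_bdp2013 hBDP W ι' K v κ Dt.f Dt.isNewformOf hN hK hodd hHN hsplit
  obtain ⟨ΩK', Ωp', L, hΩK', hL⟩ :=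
    threeAdicHsiehDescentAt_of_valueReciprocityAt W hj K N Dt v κ γ hN hK hsplit hv3 hκ ι' hVR A ΩK C Ωp Q hA hΩK hC hQ
  exact ⟨ι', hι', ΩK', Ωp', L, hΩK', hL⟩

/-! ## §3 The S2b censuses without Tate–Sen -/

/-- **Crux B ⟸ six refereed facts + TWO named facts {(T1), BDP13} + (LB-bdp) ∀-frame `ThreeAdicBDPValueAtOne` [WRITTEN] +
(LB-wan) `ThreeAdicWanDivisibility` [OPEN]** — p489731's census with Tate–Sen removed. CONDITIONAL; credits nothing.
[cite: CastellaGrossiLeeSkinner2022, §5.2 (proof of Thm. 5.2.1)] [cite: Hsieh2014, Thm. A p. 712]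
[cite: BertoliniDarmonPrasanna2013, Thm. 5.5 and (5.1.16) (p. 60)] -/
theorem cruxB_of_anyLevel_of_bdp2013_of_value_of_wan
    (hpar : ∀ (W : WeierstrassCurve ℚ) [W.IsElliptic] (p : ℕ) [Fact p.Prime], p_parity W p)
    (hmod : ModularForms.exists_isNewformOf) (hHL : HoffsteinLuo1997_exists_twist_L_one_ne_zero)
    (hKato : ∀ (W : WeierstrassCurve ℚ) [W.IsElliptic] (p : ℕ) [Fact p.Prime],
      kato_finite_of_L_one_ne_zero W p)
    (hHP : ∀ (W : WeierstrassCurve ℚ) (K : Type) [Field K] [NumberField K],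
      exists_isHeegnerPoint W K)
    (hGZ : ∀ (W : WeierstrassCurve ℚ) (N : ℕ) [NeZero N] (K : Type) [Field K] [NumberField K],
      analyticRankEK_eq_one_iff_heegner_nonTorsion W N K)
    (hT1 : Hsieh2014.thmA_exists_isHsiehLFunction_unrPeriod_anyLevel)
    (hBDP : bertoliniDarmonPrasanna2013_centralValue_reciprocity)
    (hV : ThreeAdicBDPValueAtOne) (hWan : ThreeAdicWanDivisibility) :
    AnalyticRankOneOfRankOneFiniteShaThree :=
  analyticRankOne_of_facts_of_heegnerNonTorsionOddDisc hpar hmod hHL hKato hHP hGZ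
    (heegnerNonTorsionOddDisc_of_linkA_of_existsOddDisc_of_value_of_wan hKato threeAdicControlOfRankOne_holds
      (threeAdicBDPElementExistsOddDisc_of_anyLevel_of_bdp2013 hT1 hBDP) hV hWan)

/-- **Crux A `RankPosOfThreeSelmerCorankOne` ⟸ (res) (registered `stub_threeLocNonDegeneracy`, verbatim) + TWO named facts
{(T1), BDP13} + (LB-bdp) + (LB-wan) + five refereed facts** — p490697's census with Tate–Sen removed. CONDITIONAL; credits
nothing. [cite: Skinner2020, Thm. B and §2.2–2.3 (shape of (res))] [cite: BertoliniDarmonPrasanna2013, Thm. 5.5 and (5.1.16) (p. 60)] -/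
theorem cruxA_of_res_of_anyLevel_of_bdp2013_of_value_of_wan
    (hpar : ∀ (W : WeierstrassCurve ℚ) [W.IsElliptic] (p : ℕ) [Fact p.Prime], p_parity W p)
    (hmod : ModularForms.exists_isNewformOf) (hHL : HoffsteinLuo1997_exists_twist_L_one_ne_zero)
    (hKato : ∀ (W : WeierstrassCurve ℚ) [W.IsElliptic] (p : ℕ) [Fact p.Prime],
      kato_finite_of_L_one_ne_zero W p)
    (hHP : ∀ (W : WeierstrassCurve ℚ) (K : Type) [Field K] [NumberField K],
      exists_isHeegnerPoint W K)
    (hres : ∀ (W : WeierstrassCurve ℚ) [W.IsElliptic] [W.IsGloballyMinimal], W.j = 0 →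
      ∀ (K : Type) [Field K] [NumberField K],
      IsImaginaryQuadratic K → SatisfiesHeegnerHypothesis 3 K →
        (W.baseChange K).selmerCorank 3 = 1 →
      ∀ (w : HeightOneSpectrum (𝓞 K)), ((3 : ℕ) : 𝓞 K) ∈ w.asIdeal →
        Finite ↥((W.baseChange K).selmerGroupPInfty 3 ⊓
          selmerLocalKerPrimaryTorsion (W.baseChange K) (w.adicCompletion K) 3))
    (hT1 : Hsieh2014.thmA_exists_isHsiehLFunction_unrPeriod_anyLevel)
    (hBDP : bertoliniDarmonPrasanna2013_centralValue_reciprocity)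
    (hV : ThreeAdicBDPValueAtOne) (hWan : ThreeAdicWanDivisibility) :
    RankPosOfThreeSelmerCorankOne := by
  intro D hD hc
  haveI := isElliptic_mordellCurve hD
  haveI : Fact (Nat.Prime 3) := ⟨Nat.prime_three⟩
  obtain ⟨C, hmin⟩ := hasGlobalMinimalModel_rat_holds (mordellCurve D)
  haveI : (C • mordellCurve D).IsGloballyMinimal := hmin
  have hj : (C • mordellCurve D).j = 0 := by
    rw [variableChange_j]; exact (mordellCurve D).j_eq_zero (mordellCurve_c₄ _)
  have hc' : (C • mordellCurve D).selmerCorank 3 = 1 := by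
    rw [← selmerCorank_eq_of_variableChange 3 (rfl : C • mordellCurve D = C • mordellCurve D)]
    exact hc
  have h1 := rankPosOddDisc_minimal_of_corankLinkA_of_existsOddDisc_of_value_of_wan hpar hmod hHL hKato hHP
    (threeAdicControlOfCorankOne_of_locNonDegeneracy hres)
    (threeAdicBDPElementExistsOddDisc_of_anyLevel_of_bdp2013 hT1 hBDP) hV hWan (C • mordellCurve D) hj hc'
  rwa [mordellWeilRank_variableChange_holds] at h1

/-- **The rung-S2b leaf `rankOne_threeConverse_mordellCurve` ⟸ {(res), (LB-bdp), (LB-wan)} + TWO named facts {(T1), BDP13} +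
six refereed facts** (route Assembly `MordellShaFreeCutAssembly.assembly_holds`). CONDITIONAL; neither BSD nor Sylvester's
conjecture is touched. [cite: GrossZagier1986, Thm. I.6.3 with V.§2] [cite: CastellaGrossiLeeSkinner2022, §5.2 (proof of Thm. 5.2.1)] -/
theorem leaf_of_res_of_anyLevel_of_bdp2013_of_value_of_wan
    (hpar : ∀ (W : WeierstrassCurve ℚ) [W.IsElliptic] (p : ℕ) [Fact p.Prime], p_parity W p)
    (hmod : ModularForms.exists_isNewformOf) (hHL : HoffsteinLuo1997_exists_twist_L_one_ne_zero)
    (hKato : ∀ (W : WeierstrassCurve ℚ) [W.IsElliptic] (p : ℕ) [Fact p.Prime],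
      kato_finite_of_L_one_ne_zero W p)
    (hHP : ∀ (W : WeierstrassCurve ℚ) (K : Type) [Field K] [NumberField K],
      exists_isHeegnerPoint W K)
    (hGZ : ∀ (W : WeierstrassCurve ℚ) (N : ℕ) [NeZero N] (K : Type) [Field K] [NumberField K],
      analyticRankEK_eq_one_iff_heegner_nonTorsion W N K)
    (hres : ∀ (W : WeierstrassCurve ℚ) [W.IsElliptic] [W.IsGloballyMinimal], W.j = 0 →
      ∀ (K : Type) [Field K] [NumberField K],
      IsImaginaryQuadratic K → SatisfiesHeegnerHypothesis 3 K →
        (W.baseChange K).selmerCorank 3 = 1 →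
      ∀ (w : HeightOneSpectrum (𝓞 K)), ((3 : ℕ) : 𝓞 K) ∈ w.asIdeal →
        Finite ↥((W.baseChange K).selmerGroupPInfty 3 ⊓
          selmerLocalKerPrimaryTorsion (W.baseChange K) (w.adicCompletion K) 3))
    (hT1 : Hsieh2014.thmA_exists_isHsiehLFunction_unrPeriod_anyLevel)
    (hBDP : bertoliniDarmonPrasanna2013_centralValue_reciprocity)
    (hV : ThreeAdicBDPValueAtOne) (hWan : ThreeAdicWanDivisibility) :
    rankOne_threeConverse_mordellCurve :=
  MordellShaFreeCutAssembly.assembly_holds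
    (cruxA_of_res_of_anyLevel_of_bdp2013_of_value_of_wan hpar hmod hHL hKato hHP hres hT1 hBDP hV hWan)
    (cruxB_of_anyLevel_of_bdp2013_of_value_of_wan hpar hmod hHL hKato hHP hGZ hT1 hBDP hV hWan)

/-- **THE JOINED ROAD WITHOUT Tate–Sen: crux B ⟸ ELEVEN citation-borne named facts {six refereed theorems;
`nonempty_iwasawaH2Data`, `thm12_4`, `finite_descentCokernel_of_rankOne`; (T1); BDP13} + (LB-bdp) ∀-frame value formula at 𝟙
`ThreeAdicBDPValueAtOne` [WRITTEN] + the Kato ↔ BDP reciprocity `ThreeAdicKatoBDPReciprocity` [(ERL₃), OPEN]** — p490456's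
end-state census with Tate–Sen removed. CONDITIONAL; closes nothing.
[cite: AlpogeBhargavaShnidman2022, App. A Thm. 10.1 and Thm. 10.8 (pp. 33–34)] [cite: Kato2004Asterisque, Thm. 12.4, (14.9.3), §14.14]
[cite: BertoliniDarmonPrasanna2013, Thm. 5.5 and (5.1.16) (p. 60)] [cite: Hsieh2014, Thm. A p. 712] -/
theorem cruxB_of_namedFacts_of_anyLevel_of_bdp2013_of_value_of_reciprocity
    (hpar : ∀ (W : WeierstrassCurve ℚ) [W.IsElliptic] (p : ℕ) [Fact p.Prime], p_parity W p)
    (hmod : ModularForms.exists_isNewformOf) (hHL : HoffsteinLuo1997_exists_twist_L_one_ne_zero)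
    (hKato : ∀ (W : WeierstrassCurve ℚ) [W.IsElliptic] (p : ℕ) [Fact p.Prime],
      kato_finite_of_L_one_ne_zero W p)
    (hHP : ∀ (W : WeierstrassCurve ℚ) (K : Type) [Field K] [NumberField K],
      exists_isHeegnerPoint W K)
    (hGZ : ∀ (W : WeierstrassCurve ℚ) (N : ℕ) [NeZero N] (K : Type) [Field K] [NumberField K],
      analyticRankEK_eq_one_iff_heegner_nonTorsion W N K)
    (h2 : nonempty_iwasawaH2Data) (h12 : thm12_4) (h31 : finite_descentCokernel_of_rankOne)
    (hT1 : Hsieh2014.thmA_exists_isHsiehLFunction_unrPeriod_anyLevel)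
    (hBDP : bertoliniDarmonPrasanna2013_centralValue_reciprocity)
    (hV : ThreeAdicBDPValueAtOne) (hERL : ThreeAdicKatoBDPReciprocity) :
    AnalyticRankOneOfRankOneFiniteShaThree :=
  analyticRankOne_of_facts_of_heegnerNonTorsionOddDisc hpar hmod hHL hKato hHP hGZ
    (heegnerNonTorsionOddDisc_of_prFormulaOddDisc_of_readings hKato
      (CongruentShaFreeCutKatoZetaRoadReadings.readingRK_jZero_three_of_facts nonempty_iwasawaH1Data_holds h2 h12)
      (fun _ _ _ _ D _ hD hrank hsha ↦
        CongruentShaFreeCutKatoDescentDatumOfH2.finite_coinvariants_H2_of_rankOne_of_nonempty_pinH2 h31 D hD hrank hsha)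
      (CongruentShaFreeCutKatoReading31b.reading31b_three_of_fact locP_kernel_isTorsion_of_rankOne_holds)
      (prFormulaAtThreeOddDisc_of_existsOddDisc_of_value_of_reciprocity
        (threeAdicBDPElementExistsOddDisc_of_anyLevel_of_bdp2013 hT1 hBDP) hV hERL))

end Summit.BirchSwinnertonDyer.BirchSwinnertonDyer.Theorems.MordellShaFreeCutExistenceFromTwoFacts

end
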